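import Summits.Ventures.Crystal3D.Theorems.StickyWulffConstantCoaxialWallLawSeamStarRow
import Summits.Ventures.Crystal3D.Theorems.StickyWulffConstantCoaxialWallLawSeamUnionCoreCloser
import HarnessLib

/-!
# The PAYER-FLOORED capped functional on the star-closed union core, and the repaired named input `UnionCoreStarCap s` ⇒ both T5b stubs (under E1)
# (crux `CoaxialWallLaw`, stmt-Ventures-19481; line `WallLedgerF`, skeleton 'CoaxialWallLawCertificates', repair of the refuted v8.2 input `stub_unionCoreCap`)

HONEST FRAMING. Venture `Summits/Ventures/Crystal3D` (cell `crystal3d-full`); the REPAIRED certificate-shaped input for lane F's T5b.  The v8.2 input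
`TailResidue.UnionCoreCap s` is false for every `s` ('…SeamUnionCoreCapRefuted', `not_unionCoreCap`): its conjunct «capped pools are POSITIVE at loaded balls» fails
on a lone exact cluster (capped pool `0`).  Two changes repair it without touching the comparison logic:
(1) PAYER FLOOR — the payer `z` has `deg_Y z ≤ 11`, so every pool within `1` of `z` contains at least ONE unit of true deficiency; the denominator used here is
    `payerPool cap D z b = (z-term ≥ 1) + Σ_{y ∈ D ∖ {z}, |y − b| ≤ 1} (12 − deg_D y − cap D y)⁺`, always `≥ 1` — NO positivity clause, never vacuous;
(2) STAR ROW — the cap table `capTable₃ = capTable₂ ⊓ starCap` ('…SeamStarRow') on the STAR-CLOSED union core `unionCoreStar` ('…SeamStarClosure'), valid under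
    `P5Exhaustion` (E1, the registered computational stub `stub_E1`): a lone cluster's dozen balls keep certified gain `1` each.
* `capGain`, `payerPool`, `payerSummand` (the functional; depends on the core `D`, the payer `z` and the systems only);
* `payerPool_pos`, **`payerPool_le_pooledDef`** (the floored pool never exceeds the true pool, given the junk bound at the core balls within `2` of `z`);
* **`localSummandA_le_payerSummand_unionCoreStar (hE1)`** — `Σ_A(Y, z) ≤ payerSummand capTable₃ (unionCoreStar Y z) z` at EVERY payer of degree `≤ 11`, no hypotheses
  on pools;
* **`UnionCoreStarCap s`** (NAMED INPUT, certificate-shaped, replaces `UnionCoreCap s`): for every frame `L`, `1`-separated `Y`, payer `z ∈ Y` of degree `≤ 11`,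
  `payerSummand capTable₃ v2 (S₁ L) (S₂ L) (unionCoreStar …) z ≤ s`;  `unionCoreStarCap_mono`;
* **`localSummandA_le_of_unionCoreStarCap`**, **`seamResidual_of_unionCoreStarCap`**, **`coherentSeamSmall_of_unionCoreStarCap`**,
  **`incoherentSeamSmall_of_unionCoreStarCap`**, **`t5b_of_unionCoreStarCap`** — all under `(hE1 : P5Exhaustion)`: both registered T5b stubs of 'Certificates'
  close BY NAME from `stub_E1` and `UnionCoreStarCap (2 * Real.sqrt 6)`.
WHAT THIS IS NOT: `UnionCoreStarCap (2√6)` is OPEN (cf-p2-style enumeration of star-closed union cores around a payer + the crowding of foreign exact clusters);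
on the refuting witness of the old input its functional is `3 · (1/5) = 0.6`.  F-C1 not moved.
-/

noncomputable section

namespace Summit.Ventures.Crystal3D.Theorems

namespace TailResidue

open Summit.Ventures.Crystal3D Finset
open scoped InnerProductSpace

/-! ### The payer-floored pool and functional -/

section Functional

variable (cap : Finset (EuclideanSpace ℝ (Fin 3)) → EuclideanSpace ℝ (Fin 3) → ℕ)

open scoped Classical in
/-- The CERTIFIED GAIN of the core ball `y`: `(12 − #core contacts − cap)⁺`, a lower bound for its true deficiency whenever `cap` bounds its junk contacts. -/
def capGain (D : Finset (EuclideanSpace ℝ (Fin 3))) (y : EuclideanSpace ℝ (Fin 3)) : ℝ :=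
  max 0 ((12 : ℝ) - ((D.filter fun q => dist y q = 1).card : ℝ) - (cap D y : ℝ))

open scoped Classical in
/-- **THE PAYER-FLOORED POOL** of the core ball `b` at the payer `z`: the payer's unit (or its certified gain if larger) plus the certified gains of the other core
balls within `1` of `b`.  Always `≥ 1`. -/
def payerPool (D : Finset (EuclideanSpace ℝ (Fin 3))) (z b : EuclideanSpace ℝ (Fin 3)) : ℝ :=
  (if z ∈ D then max 1 (capGain cap D z) else 1) + ∑ y ∈ (D.erase z).filter (fun y => dist b y ≤ 1), capGain cap D y

open scoped Classical in
/-- **THE PAYER-FLOORED CAPPED (A)-SUMMAND** of the core `D` at the payer `z` for the systems `(S₁, S₂)`. -/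
def payerSummand (v : WordVersion) (S₁ S₂ : PlateSystem) (D : Finset (EuclideanSpace ℝ (Fin 3))) (z : EuclideanSpace ℝ (Fin 3)) : ℝ :=
  ∑ b ∈ D.filter (fun b => dist z b ≤ 1 ∧ 0 < endMultA D v S₁ S₂ b), (endMultA D v S₁ S₂ b : ℝ) / payerPool cap D z b

variable {cap}

/-- Certified gains are nonnegative. -/
theorem capGain_nonneg (D : Finset (EuclideanSpace ℝ (Fin 3))) (y : EuclideanSpace ℝ (Fin 3)) : 0 ≤ capGain cap D y := le_max_left _ _

open scoped Classical in
/-- **The payer-floored pool is at least `1`.** -/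
theorem one_le_payerPool (D : Finset (EuclideanSpace ℝ (Fin 3))) (z b : EuclideanSpace ℝ (Fin 3)) : 1 ≤ payerPool cap D z b := by
  unfold payerPool
  have h1 : (1 : ℝ) ≤ if z ∈ D then max 1 (capGain cap D z) else 1 := by
    split_ifs
    · exact le_max_left _ _
    · exact le_rfl
  have h2 : (0 : ℝ) ≤ ∑ y ∈ (D.erase z).filter (fun y => dist b y ≤ 1), capGain cap D y := sum_nonneg fun y _ => capGain_nonneg D y
  linarith

/-- The payer-floored pool is positive. -/
theorem payerPool_pos (D : Finset (EuclideanSpace ℝ (Fin 3))) (z b : EuclideanSpace ℝ (Fin 3)) : 0 < payerPool cap D z b :=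
  lt_of_lt_of_le one_pos (one_le_payerPool D z b)

open scoped Classical in
/-- The functional is a sum of nonnegative terms. -/
theorem payerSummand_nonneg (v : WordVersion) (S₁ S₂ : PlateSystem) (D : Finset (EuclideanSpace ℝ (Fin 3))) (z : EuclideanSpace ℝ (Fin 3)) :
    0 ≤ payerSummand cap v S₁ S₂ D z :=
  sum_nonneg fun b _ => div_nonneg (Nat.cast_nonneg _) (payerPool_pos D z b).le

end Functional

/-! ### The floored pool never exceeds the true pool -/

section Compare

variable {cap : Finset (EuclideanSpace ℝ (Fin 3)) → EuclideanSpace ℝ (Fin 3) → ℕ} {X D : Finset (EuclideanSpace ℝ (Fin 3))}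
  (hX : ∀ p ∈ X, ∀ q ∈ X, p ≠ q → 1 ≤ dist p q) (hDX : D ⊆ X) {z : EuclideanSpace ℝ (Fin 3)}
  (hjunk : ∀ y ∈ D, dist z y ≤ 2 → ((X \ D).filter fun x => dist y x = 1).card ≤ cap D y)

open scoped Classical in
/-- The true pool written as a sum over ALL balls within `1` (balls with twelve contacts contribute `0`). -/
theorem pooledDef_eq_sum (hX : ∀ p ∈ X, ∀ q ∈ X, p ≠ q → 1 ≤ dist p q) (b : EuclideanSpace ℝ (Fin 3)) :
    pooledDef X b = ∑ x ∈ X.filter (fun x => dist b x ≤ 1), ((12 : ℝ) - ((X.filter fun q => dist x q = 1).card : ℝ)) := by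
  unfold pooledDef
  refine sum_subset (fun x hx => mem_filter.2 ⟨(mem_filter.1 hx).1, (mem_filter.1 hx).2.1⟩) fun x hx hnx => ?_
  obtain ⟨hxX, hbx⟩ := mem_filter.1 hx
  have h12 := card_filter_dist_eq_one_le_twelve X hX x
  have hgt : ¬ (X.filter fun q => dist x q = 1).card ≤ 11 := fun h => hnx (mem_filter.2 ⟨hxX, hbx, h⟩)
  have heq : (X.filter fun q => dist x q = 1).card = 12 := by omega
  rw [heq]
  norm_num

include hX hDX hjunk in
open scoped Classical in
/-- The certified gain of a core ball within `2` of the payer is at most its true deficiency. -/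
theorem capGain_le_deficiency {y : EuclideanSpace ℝ (Fin 3)} (hy : y ∈ D) (hzy : dist z y ≤ 2) :
    capGain cap D y ≤ (12 : ℝ) - ((X.filter fun q => dist y q = 1).card : ℝ) := by
  have hsplit := card_contacts_eq_junk_add_core hDX y
  have hj := hjunk y hy hzy
  have h12 := card_filter_dist_eq_one_le_twelve X hX y
  unfold capGain
  refine max_le ?_ ?_
  · have : ((X.filter fun q => dist y q = 1).card : ℝ) ≤ 12 := by exact_mod_cast h12
    linarith
  · have : ((X.filter fun q => dist y q = 1).card : ℝ) ≤ ((D.filter fun q => dist y q = 1).card : ℝ) + (cap D y : ℝ) := by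
      exact_mod_cast (show (X.filter fun q => dist y q = 1).card ≤ (D.filter fun q => dist y q = 1).card + cap D y by omega)
    linarith

include hX hDX hjunk in
open scoped Classical in
/-- **The payer-floored pool never exceeds the true pool**: the payer `z ∈ X` (degree `≤ 11`) lies within `1` of `b` and carries one unit of true deficiency (or its
certified gain), and every other core ball within `1` of `b` carries at least its certified gain. -/
theorem payerPool_le_pooledDef (hz : z ∈ X) (hdeg : (X.filter fun q => dist z q = 1).card ≤ 11) {b : EuclideanSpace ℝ (Fin 3)} (hzb : dist z b ≤ 1) :
    payerPool cap D z b ≤ pooledDef X b := by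
  rw [pooledDef_eq_sum hX b]
  set T := (D.erase z).filter (fun y => dist b y ≤ 1) with hT
  have hzmem : z ∈ X.filter (fun x => dist b x ≤ 1) := mem_filter.2 ⟨hz, by rwa [dist_comm]⟩
  have hTsub : T ⊆ X.filter (fun x => dist b x ≤ 1) := fun y hy => mem_filter.2 ⟨hDX (mem_of_mem_erase (mem_filter.1 hy).1), (mem_filter.1 hy).2⟩
  have hzT : z ∉ T := fun h => notMem_erase z D (mem_filter.1 h).1
  have hins : insert z T ⊆ X.filter (fun x => dist b x ≤ 1) := insert_subset hzmem hTsub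
  have hzterm : (if z ∈ D then max 1 (capGain cap D z) else 1) ≤ (12 : ℝ) - ((X.filter fun q => dist z q = 1).card : ℝ) := by
    have h1 : (1 : ℝ) ≤ (12 : ℝ) - ((X.filter fun q => dist z q = 1).card : ℝ) := by
      have : ((X.filter fun q => dist z q = 1).card : ℝ) ≤ 11 := by exact_mod_cast hdeg
      linarith
    split_ifs with hzD
    · exact max_le h1 (capGain_le_deficiency hX hDX hjunk hzD (by simp))
    · exact h1
  have hterms : ∀ y ∈ T, capGain cap D y ≤ (12 : ℝ) - ((X.filter fun q => dist y q = 1).card : ℝ) := by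
    intro y hy
    obtain ⟨hy, hby⟩ := mem_filter.1 hy
    exact capGain_le_deficiency hX hDX hjunk (mem_of_mem_erase hy) (by linarith [dist_triangle z b y])
  have hnonneg : ∀ x ∈ X.filter (fun x => dist b x ≤ 1), x ∉ insert z T → (0 : ℝ) ≤ (12 : ℝ) - ((X.filter fun q => dist x q = 1).card : ℝ) := by
    intro x _ _
    have : ((X.filter fun q => dist x q = 1).card : ℝ) ≤ 12 := by exact_mod_cast card_filter_dist_eq_one_le_twelve X hX x
    linarith
  calc payerPool cap D z b
      = (if z ∈ D then max 1 (capGain cap D z) else 1) + ∑ y ∈ T, capGain cap D y := rfl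
    _ ≤ ((12 : ℝ) - ((X.filter fun q => dist z q = 1).card : ℝ)) + ∑ y ∈ T, ((12 : ℝ) - ((X.filter fun q => dist y q = 1).card : ℝ)) :=
        add_le_add hzterm (sum_le_sum hterms)
    _ = ∑ x ∈ insert z T, ((12 : ℝ) - ((X.filter fun q => dist x q = 1).card : ℝ)) := by rw [sum_insert hzT]
    _ ≤ ∑ x ∈ X.filter (fun x => dist b x ≤ 1), ((12 : ℝ) - ((X.filter fun q => dist x q = 1).card : ℝ)) :=
        sum_le_sum_of_subset_of_nonneg hins hnonneg

end Compare

/-! ### The comparison at a payer: `Σ_A(Y, z) ≤ payerSummand capTable₃ (unionCoreStar) z` -/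

open scoped Classical in
/-- **THE REPAIRED MULTI-PIECE ENDPOINT (under E1)**: at every payer `z ∈ Y` of degree `≤ 11` of a `1`-separated `Y`, for any systems with slot roots,
`Σ_A(Y, z) ≤ payerSummand capTable₃ v S₁ S₂ (unionCoreStar Y z v S₁ S₂) z` — every (A)-pair counted once in the star-closed union core, pools floored by the payer's
unit and lowered only by certified gains.  NO hypothesis on the core's pools. -/
theorem localSummandA_le_payerSummand_unionCoreStar (hE1 : P5Exhaustion) {Y : Finset (EuclideanSpace ℝ (Fin 3))}
    (hY : ∀ p ∈ Y, ∀ p' ∈ Y, p ≠ p' → 1 ≤ dist p p') {v : WordVersion} {S₁ S₂ : PlateSystem} (h₁ : S₁.RT ⊆ fccSlots) (h₂ : S₂.RT ⊆ fccSlots)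
    {z : EuclideanSpace ℝ (Fin 3)} (hz : z ∈ Y) (hdeg : (Y.filter fun q => dist z q = 1).card ≤ 11) :
    localSummandA v S₁ S₂ Y z ≤ payerSummand capTable₃ v S₁ S₂ (unionCoreStar Y z v S₁ S₂) z := by
  set D := unionCoreStar Y z v S₁ S₂ with hDdef
  have hD : IsStarClosed Y z D := isStarClosed_unionCoreStar
  have hDY : D ⊆ Y := hD.subset
  have hjunk : ∀ y ∈ D, dist z y ≤ 2 → ((Y \ D).filter fun x => dist y x = 1).card ≤ capTable₃ D y :=
    fun y hy hzy => junkCapBoundStar_capTable₃ hE1 Y hY z D hD y hy hzy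
  unfold localSummandA payerSummand
  have hsub : Y.filter (fun b => dist z b ≤ 1 ∧ 0 < endMultA Y v S₁ S₂ b) ⊆ D.filter (fun b => dist z b ≤ 1 ∧ 0 < endMultA D v S₁ S₂ b) := by
    intro b hb
    obtain ⟨-, hzb, he⟩ := mem_filter.1 hb
    have hle : endMultA Y v S₁ S₂ b ≤ endMultA D v S₁ S₂ b := endMultA_le_unionCoreStar hY h₁ h₂ hzb
    obtain ⟨q, hq⟩ := card_pos.1 he
    have hpD := isEndPairA_unionCoreStar hY h₁ h₂ hzb (mem_filter.1 hq).2
    exact mem_filter.2 ⟨hpD.2.1, hzb, lt_of_lt_of_le he hle⟩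
  calc ∑ b ∈ Y.filter (fun b => dist z b ≤ 1 ∧ 0 < endMultA Y v S₁ S₂ b), (endMultA Y v S₁ S₂ b : ℝ) / pooledDef Y b
      ≤ ∑ b ∈ Y.filter (fun b => dist z b ≤ 1 ∧ 0 < endMultA Y v S₁ S₂ b), (endMultA D v S₁ S₂ b : ℝ) / payerPool capTable₃ D z b := by
        refine sum_le_sum fun b hb => ?_
        obtain ⟨-, hzb, -⟩ := mem_filter.1 hb
        exact div_le_div₀ (Nat.cast_nonneg _) (Nat.cast_le.2 (endMultA_le_unionCoreStar hY h₁ h₂ hzb)) (payerPool_pos D z b)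
          (payerPool_le_pooledDef hY hDY hjunk hz hdeg hzb)
    _ ≤ ∑ b ∈ D.filter (fun b => dist z b ≤ 1 ∧ 0 < endMultA D v S₁ S₂ b), (endMultA D v S₁ S₂ b : ℝ) / payerPool capTable₃ D z b :=
        sum_le_sum_of_subset_of_nonneg hsub fun b _ _ => div_nonneg (Nat.cast_nonneg _) (payerPool_pos D z b).le

/-! ### The repaired named input and the by-name consequences -/

open scoped Classical in
/-- **STAR-CLOSED UNION-CORE CERTIFICATE at the line `s` (named input; replaces the refuted `UnionCoreCap s`)**: at every payer `z ∈ Y` of degree `≤ 11` of a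
`1`-separated configuration, for every frame `L`, the payer-floored capped (A)-summand (cap table `capTable₃` = table of record ⊓ star row, systems `v2`, basal
systems of `L` and of its half-turn) of the STAR-CLOSED UNION CORE of `z` is `≤ s`.  A function of the core and the payer only; no positivity clause. -/
def UnionCoreStarCap (s : ℝ) : Prop :=
  ∀ L : EuclideanSpace ℝ (Fin 3) ≃ₗᵢ[ℝ] EuclideanSpace ℝ (Fin 3),
  ∀ Y : Finset (EuclideanSpace ℝ (Fin 3)), (∀ p ∈ Y, ∀ q ∈ Y, p ≠ q → 1 ≤ dist p q) →
  ∀ z ∈ Y, (Y.filter fun q => dist z q = 1).card ≤ 11 →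
    payerSummand capTable₃ WordVersion.v2 (basalSystem L) (basalSystem (((ℝ ∙ EuclideanSpace.single (2 : Fin 3) (1 : ℝ)).reflection).trans L))
      (unionCoreStar Y z WordVersion.v2 (basalSystem L) (basalSystem (((ℝ ∙ EuclideanSpace.single (2 : Fin 3) (1 : ℝ)).reflection).trans L))) z ≤ s

/-- Monotonicity in the line. -/
theorem unionCoreStarCap_mono {s s' : ℝ} (h : UnionCoreStarCap s) (hs : s ≤ s') : UnionCoreStarCap s' := fun L Y hY z hz hdeg => (h L Y hY z hz hdeg).trans hs

open scoped Classical in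
/-- **`P5Exhaustion ⇒ UnionCoreStarCap s ⇒ Σ_A(Y, z) ≤ s`** at every payer of degree `≤ 11` (no residual hypotheses used). -/
theorem localSummandA_le_of_unionCoreStarCap (hE1 : P5Exhaustion) {s : ℝ} (h : UnionCoreStarCap s) (L : EuclideanSpace ℝ (Fin 3) ≃ₗᵢ[ℝ] EuclideanSpace ℝ (Fin 3))
    {Y : Finset (EuclideanSpace ℝ (Fin 3))} (hY : ∀ p ∈ Y, ∀ q ∈ Y, p ≠ q → 1 ≤ dist p q) {z : EuclideanSpace ℝ (Fin 3)} (hz : z ∈ Y)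
    (hdeg : (Y.filter fun q => dist z q = 1).card ≤ 11) :
    localSummandA WordVersion.v2 (basalSystem L) (basalSystem (((ℝ ∙ EuclideanSpace.single (2 : Fin 3) (1 : ℝ)).reflection).trans L)) Y z ≤ s := by
  have h₁ : (basalSystem L).RT ⊆ fccSlots := filter_subset _ _
  have h₂ : (basalSystem (((ℝ ∙ EuclideanSpace.single (2 : Fin 3) (1 : ℝ)).reflection).trans L)).RT ⊆ fccSlots := filter_subset _ _
  exact (localSummandA_le_payerSummand_unionCoreStar hE1 hY h₁ h₂ hz hdeg).trans (h L Y hY z hz hdeg)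

/-- **`P5Exhaustion ⇒ UnionCoreStarCap s ⇒ SeamResidual s k₀`** (any `k₀`). -/
theorem seamResidual_of_unionCoreStarCap (hE1 : P5Exhaustion) {s : ℝ} {k₀ : ℕ} (h : UnionCoreStarCap s) : SeamResidual s k₀ :=
  fun L _ hY _ hz hdeg _ _ _ _ => Or.inr (localSummandA_le_of_unionCoreStarCap hE1 h L hY hz hdeg)

/-- **`P5Exhaustion ⇒ UnionCoreStarCap s ⇒ CoherentSeamSmall s k₀`.** -/
theorem coherentSeamSmall_of_unionCoreStarCap (hE1 : P5Exhaustion) {s : ℝ} {k₀ : ℕ} (h : UnionCoreStarCap s) : CoherentSeamSmall s k₀ :=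
  fun L _ hY _ hz hdeg _ _ _ _ _ => Or.inr (localSummandA_le_of_unionCoreStarCap hE1 h L hY hz hdeg)

/-- **`P5Exhaustion ⇒ UnionCoreStarCap s ⇒ IncoherentSeamSmall s k₀`.** -/
theorem incoherentSeamSmall_of_unionCoreStarCap (hE1 : P5Exhaustion) {s : ℝ} {k₀ : ℕ} (h : UnionCoreStarCap s) : IncoherentSeamSmall s k₀ :=
  fun L _ hY _ hz hdeg _ _ _ _ _ => Or.inr (localSummandA_le_of_unionCoreStarCap hE1 h L hY hz hdeg)

/-- **The shape lane F's by-name closers take**: `stub_E1 : P5Exhaustion` and `UnionCoreStarCap (2√6)` close both T5b stubs at `k₀ = 3`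
(`stub_coherentSeamSmall := (t5b_of_unionCoreStarCap stub_E1 stub_unionCoreStarCap).1`, `stub_incoherentSeamSmall := (…).2`). -/
theorem t5b_of_unionCoreStarCap (hE1 : P5Exhaustion) (h : UnionCoreStarCap (2 * Real.sqrt 6)) :
    CoherentSeamSmall (2 * Real.sqrt 6) 3 ∧ IncoherentSeamSmall (2 * Real.sqrt 6) 3 :=
  ⟨coherentSeamSmall_of_unionCoreStarCap hE1 h, incoherentSeamSmall_of_unionCoreStarCap hE1 h⟩

end TailResidue

end Summit.Ventures.Crystal3D.Theorems

end
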